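import Literature.NumberTheory.EllipticCurves.BigGaloisRepSelmer
import Mathlib.GroupTheory.QuotientGroup.Finite
import Mathlib.NumberTheory.Padics.PadicIntegers
import HarnessLib

/-!
# Crux 4 `BSDpOnCellC` (stmt-BirchSwinnertonDyer-19034), line `telescope`, leaves N2 `stub_weightTwoControl` / N3
# `stub_memberControl`: INPUT SHAPES for the finite global control defect — the finite `ker κ`-fixed `c`-torsion of `A` from a
# quasi-isomorphism (N1's (fd₀)/(fd_k)), and `(X − C x_k)`-power torsion at the member weights from N1's (tor)
# (helper, `--supports stmt-BirchSwinnertonDyer-19034 --as helper`; closes nothing)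

Cell `bsd-eis`, width seat `bsd-line-x2-p2` (prover g19, 2026-08-29; D-0154 KEY row 5). THEOREMS ONLY: no definition, no named
fact, no `sorry`, no instance, no notation. Companion (independent, may land in either order) of
`Theorems/EisensteinPrimesBSDpOnCellCTelescopeK2GlobalDefectFinite.lean`, whose binder theorem
`TelescopeK2GlobalDefectFinite.finite_quotSMulTop_invariants_anticyclotomic` (= `hglob` of `TelescopeK2WeightControl.twoSided_finite_control`,
p737740, at `r = C c`) takes two hypotheses about the coefficient module `A` of `M₂ = AnticyclotomicBigGaloisRep κ ρ`:
(htor) every `p`-primary `a ∈ A` is `c`-power torsion; (hfin) `{a ∈ A | c • a = 0, a fixed by ker κ}` is finite. This file supplies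
both in the SHAPES of the registered leaf N1 `stub_branchLattice` (telescope v8):

* `finite_fixed_torsionBy_of_addMonoidHom` — (hfin) from an additive `θ₀ : A[c] → P` with FINITE KERNEL intertwining
  `BigGaloisRep.torsionRep ρ c` with an action `ρ'` on `P` whose `ker κ`-fixed vectors are finite: N1's (fd₀)
  `θ₀ : A₂[X] → E[p^∞]` (`E(K_∞)[p^∞]` finite for the non-CM Cell-C curve — the consumer's arithmetic input, NOT proved here) and
  (fd_k) `θ : A₂[X − x_k] → A_{g_k}†`;
* `pow_sub_C_smul_eq_zero` / `exists_pow_sub_C_smul_eq_zero` — (htor) at the member weight `c = X − C x_k`, `‖x_k‖ < 1`, over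
  `𝒪₂ = ℤ_p⟦X⟧`: an `X`-power-torsion (N1's (tor)), `p`-primary element is `(X − C x)`-power torsion for every `x ∈ pℤ_p`
  (binomial expansion; `(X − C x)^{n+k} • a = 0` if `X^n • a = 0`, `p^k • a = 0`).

HONEST FRAMING: elementary algebra over binders; nothing about any curve, newform or branch lattice is asserted; BSD is proved
for no pair; no registered stub, crux or summit statement is proved by this file; closes: none.

## References
* [Castella2018Erratum] §2 (the members `g_m` and `M_g[ϖ^m] ≃ M_f[ϖ^m]`), Lemma 2.1 (p. 2).
* [GreenbergLNM1716] §4, proof of Prop. 4.10 («`E(K_∞)_{tors}` is finite» as the input of the global defect).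
-/

noncomputable section

-- D-0017: single-problem summit, the namespace repeats the problem name by design.
set_option linter.dupNamespace false
set_option autoImplicit false

open Literature.NumberTheory.GaloisRepresentations Literature.NumberTheory.EllipticCurves

namespace Summit.BirchSwinnertonDyer.BirchSwinnertonDyer.Theorems.TelescopeK2GlobalDefectInputs

/-! ## §1 The finite `ker κ`-fixed `c`-torsion from a quasi-isomorphism; §2 member weights -/

section Inputs

universe w

variable {𝒪 : Type*} [CommRing 𝒪] [TopologicalSpace 𝒪] {p : ℕ} [Fact p.Prime]
  {A : Type w} [AddCommGroup A] [Module 𝒪 A] [TopologicalSpace A] [DiscreteTopology A]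
  {G : Type w} [Group G] [TopologicalSpace G]

omit [DiscreteTopology A] in
/-- **The finite set from a quasi-isomorphism (the (fd₀)/(fd_k) shape of N1 `stub_branchLattice`).** If an additive map
`θ₀ : A[c] → P` with FINITE KERNEL intertwines `ρ` on `A[c]` (`BigGaloisRep.torsionRep ρ c`) with an action `ρ'` on `P` whose
`ker κ`-fixed vectors are finite (`P = E[p^∞]`, `E(K_∞)[p^∞]` finite), then `{a ∈ A[c] : a fixed by ker κ}` is finite.
[cite: GreenbergLNM1716, §4, proof of Prop. 4.10 (E(K_∞)_tors finite)] [folklore] -/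
theorem finite_fixed_torsionBy_of_addMonoidHom (κ : G →ₜ* Multiplicative ℤ_[p]) (ρ : ContinuousRep G 𝒪 A) (c : 𝒪)
    {P : Type*} [AddCommGroup P] (ρ' : G → P → P)
    (θ₀ : Submodule.torsionBy 𝒪 A c →+ P)
    (hθ : ∀ (σ : G) (a : Submodule.torsionBy 𝒪 A c), θ₀ (BigGaloisRep.torsionRep ρ c σ a) = ρ' σ (θ₀ a))
    (hker : Finite θ₀.ker) (hP : Set.Finite {e : P | ∀ g : G, κ g = 1 → ρ' g e = e}) :
    Set.Finite {a : A | c • a = 0 ∧ ∀ g : G, κ g = 1 → ρ g a = a} := by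
  -- the subgroup `T ≤ A[c]` of `ker κ`-fixed vectors
  let T : AddSubgroup (Submodule.torsionBy 𝒪 A c) :=
    { carrier := {a | ∀ g : G, κ g = 1 → ρ g (a : A) = a}
      zero_mem' := fun g _ => by simp
      add_mem' := fun {a b} ha hb g hg => by
        rw [Submodule.coe_add, map_add, ha g hg, hb g hg]
      neg_mem' := fun {a} ha g hg => by
        rw [Submodule.coe_neg, map_neg, ha g hg] }
  let θT : T →+ P := θ₀.comp T.subtype
  -- finite kernel
  haveI : Finite θT.ker := by
    haveI := hker
    refine Finite.of_injective (fun a : θT.ker => (⟨((a : T) : Submodule.torsionBy 𝒪 A c), by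
      have ha := a.2
      rw [AddMonoidHom.mem_ker] at ha ⊢
      exact ha⟩ : θ₀.ker)) ?_
    intro a b h
    apply Subtype.ext
    apply Subtype.ext
    exact congrArg (fun z : θ₀.ker => (z : Submodule.torsionBy 𝒪 A c)) h
  -- finite image
  haveI : Finite θT.range := by
    haveI := hP.to_subtype
    refine Finite.of_injective (fun e : θT.range => (⟨(e : P), ?_⟩ :
      {e : P | ∀ g : G, κ g = 1 → ρ' g e = e})) ?_
    · obtain ⟨a, ha⟩ := e.2
      intro g hg
      rw [← ha]
      change ρ' g (θ₀ (a : Submodule.torsionBy 𝒪 A c)) = θ₀ (a : Submodule.torsionBy 𝒪 A c)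
      rw [← hθ]
      congr 1
      apply Subtype.ext
      rw [BigGaloisRep.torsionRep_apply_coe]
      exact a.2 g hg
    · intro a b h
      have h' := congrArg (fun z : {e : P | ∀ g : G, κ g = 1 → ρ' g e = e} => (z : P)) h
      exact Subtype.ext h'
  haveI : Finite (T ⧸ θT.ker) := Finite.of_equiv _ (QuotientAddGroup.quotientKerEquivRange θT).toEquiv.symm
  haveI : Finite T := Finite.of_addSubgroup_quotient θT.ker
  -- the set injects into `T`
  haveI : Finite {a : A | c • a = 0 ∧ ∀ g : G, κ g = 1 → ρ g a = a} := by
    refine Finite.of_injective (fun a : {a : A | c • a = 0 ∧ ∀ g : G, κ g = 1 → ρ g a = a} =>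
      (⟨⟨(a : A), (Submodule.mem_torsionBy_iff c (a : A)).2 a.2.1⟩, fun g hg => a.2.2 g hg⟩ : T)) ?_
    intro a b h
    exact Subtype.ext (congrArg (fun z : T => ((z : Submodule.torsionBy 𝒪 A c) : A)) h)
  exact Set.toFinite _

/-- **Member weights.** Over `𝒪₂ = ℤ_p⟦X⟧`: if `X ^ n • a = 0` and `p ^ k • a = 0` then `(X − C x) ^ (n + k) • a = 0` for every
`x ∈ pℤ_p` (binomial expansion: a term has `X^i` with `i ≥ n` or `x^j` with `j > k`, `p^j ∣ x^j`). With N1's (tor) and the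
`p`-primarity of the values this is the hypothesis `htor` of §2 at the member weight `c = X − C x_k`, `‖x_k‖ < 1`.
[cite: Castella2018Erratum, §2 (the specialisations of 𝐓 at the members)] [folklore] -/
theorem pow_sub_C_smul_eq_zero {A₂ : Type*} [AddCommGroup A₂] [Module (PowerSeries ℤ_[p]) A₂]
    (x : ℤ_[p]) (hx : ‖x‖ < 1) (a : A₂) (n k : ℕ)
    (hX : (PowerSeries.X : PowerSeries ℤ_[p]) ^ n • a = 0) (hp : p ^ k • a = 0) :
    (PowerSeries.X - PowerSeries.C x : PowerSeries ℤ_[p]) ^ (n + k) • a = 0 := by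
  obtain ⟨y, hy⟩ := (PadicInt.norm_lt_one_iff_dvd x).1 hx
  -- `(C x)^k` kills `a`: `x^k = p^k y^k`
  have hpk : ((p : PowerSeries ℤ_[p]) ^ k) • a = 0 := by
    rw [← Nat.cast_pow, Nat.cast_smul_eq_nsmul]
    exact hp
  have hCk : (PowerSeries.C x : PowerSeries ℤ_[p]) ^ k • a = 0 := by
    rw [← map_pow, hy, mul_pow, map_mul, map_pow, map_natCast, mul_comm, mul_smul, hpk, smul_zero]
  rw [sub_eq_add_neg, add_pow, Finset.sum_smul]
  refine Finset.sum_eq_zero fun i hi => ?_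
  by_cases hin : n ≤ i
  · -- `X^i • a = 0`
    obtain ⟨d, rfl⟩ := Nat.exists_eq_add_of_le hin
    have hXi : (PowerSeries.X : PowerSeries ℤ_[p]) ^ (n + d) • a = 0 := by
      rw [pow_add, mul_comm, mul_smul, hX, smul_zero]
    rw [show (PowerSeries.X : PowerSeries ℤ_[p]) ^ (n + d) * (-PowerSeries.C x) ^ (n + k - (n + d)) *
        ((n + k).choose (n + d) : PowerSeries ℤ_[p]) =
        ((-PowerSeries.C x) ^ (n + k - (n + d)) * ((n + k).choose (n + d) : PowerSeries ℤ_[p])) *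
          PowerSeries.X ^ (n + d) from by ring, mul_smul, hXi, smul_zero]
  · -- `i < n`: the exponent of `-C x` is `k + (n - i)` and `(C x)^k` kills `a`
    have hj : n + k - i = k + (n - i) := by omega
    have hC : (-PowerSeries.C x : PowerSeries ℤ_[p]) ^ (n + k - i) • a = 0 := by
      rw [hj, show (-PowerSeries.C x : PowerSeries ℤ_[p]) ^ (k + (n - i)) =
        ((-1) ^ (k + (n - i)) * PowerSeries.C x ^ (n - i)) * PowerSeries.C x ^ k from by
          rw [neg_pow, pow_add]; ring, mul_smul, hCk, smul_zero]
    rw [show (PowerSeries.X : PowerSeries ℤ_[p]) ^ i * (-PowerSeries.C x) ^ (n + k - i) *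
        ((n + k).choose i : PowerSeries ℤ_[p]) =
        (PowerSeries.X ^ i * ((n + k).choose i : PowerSeries ℤ_[p])) * (-PowerSeries.C x) ^ (n + k - i) from by ring,
      mul_smul, hC, smul_zero]

/-- The existential form: an `X`-power-torsion, `p`-primary element of a `ℤ_p⟦X⟧`-module is `(X − C x)`-power torsion for
`x ∈ pℤ_p`. [cite: Castella2018Erratum, §2] [folklore] -/
theorem exists_pow_sub_C_smul_eq_zero {A₂ : Type*} [AddCommGroup A₂] [Module (PowerSeries ℤ_[p]) A₂]
    (x : ℤ_[p]) (hx : ‖x‖ < 1) (a : A₂)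
    (hX : ∃ n : ℕ, (PowerSeries.X : PowerSeries ℤ_[p]) ^ n • a = 0) (hp : ∃ k : ℕ, p ^ k • a = 0) :
    ∃ N : ℕ, (PowerSeries.X - PowerSeries.C x : PowerSeries ℤ_[p]) ^ N • a = 0 := by
  obtain ⟨n, hn⟩ := hX
  obtain ⟨k, hk⟩ := hp
  exact ⟨n + k, pow_sub_C_smul_eq_zero x hx a n k hn hk⟩

end Inputs

end Summit.BirchSwinnertonDyer.BirchSwinnertonDyer.Theorems.TelescopeK2GlobalDefectInputs

end
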